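import Summits.Ventures.Crystal3D.Theorems.StickyWulffConstantCoaxialWallLawDoubleVacancyLens
import HarnessLib

/-!
# The equatorial ribbon of the fcc kissing shell (third riser atom of the wall ledger)

HONEST FRAMING. Part of the venture `Summits/Ventures/Crystal3D` (cell `crystal3d-full`), helper
`--supports` the crux `CoaxialWallLaw` (stmt-Ventures-19481, `route-Ventures-StickyWulffConstant`),
REGISTERED line `WallLedgerF` (planner cf-p1 gen 16), stub `stub_coaxialTwoSlabAdhesion`
(terrace/riser slot ledger).  Continues `…SingleVacancy` (`k = 1`) and `…DoubleVacancyLens`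
(lens lemma).  Pure algebra in the cubic frame of `D₃` (`2‖p‖² = A² + B² + C²`), with the BASAL
AXIS of the co-axial pair taken as the body diagonal `n = (−1, 1, 1)` (the image of `e₃`: the
height of `(a, b, c)` along the axis is `(−a + b + c)/√6`, a bond vector has height `±√(2/3)`
or `0`).  The twelve slots split into the six IN-PLANE slots `U` (`⟨s, n⟩ = 0`: `±(1,1,0),
±(1,0,1), ±(0,1,−1)`, a regular hexagon) and the six OUT-OF-PLANE slots `V` (`(−1,1,0), (−1,0,1),
(0,1,1)` above, their negatives below).

A foreign ball touching a host lattice ball whose six out-of-plane slots are all OCCUPIED has a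
direction `x` (norm² `2`) with `⟨x, v⟩ ≤ 1` for all `v ∈ V`.  This file proves what such an `x`
looks like (numerically: 60 917 / 60 917 sampled feasible directions, this seat's
calc/ribbon.py; here in the kernel):

* `ribbon_height_le` — **`|−a + b + c| ≤ 2/3`**, i.e. the foreign ball sits within height `d/3`
  (`d = √(2/3)` the layer spacing) of the host's basal plane (sharp: the face-twin cap points).
  Proof: with `p = b − a`, `q = c − a`, `r = b + c ∈ [−1, 1]` and `S = p + q + r = 2(−a+b+c)`,
  the norm gives `4(p² + q² + r²) = 8 + S²`, whence `S² ≤ 4p², 4q², 4r²`; a sign count then gives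
  `|S| ≤ 4/3`.
* `ribbon_blocked_adjacent` — `x` can be within overlap range (`⟨x, u⟩ > 1`) of at most two
  in-plane slots, and two such are ADJACENT hexagon vertices (`120°` pairs `u, u''` have
  `u + u'' ∈ U`, so `⟨x,u⟩ + ⟨x,u''⟩ = ⟨x, u+u''⟩ ≤ 2`; antipodes are trivial);
* `ribbon_sign` — if `x` is within overlap range of the adjacent in-plane pair `u, u'` and is
  not one of these two slots, then its height has the sign OPPOSITE to the common out-of-plane
  neighbour `v₀` of `u, u'` (the third vertex of their triangular face): the lens between two
  in-plane slots is pushed to the far side of the basal plane (`cubicShell_lens_aux`: in the face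
  frame `p ≥ 1`, `q, r ≥ 0`, `q + r ≤ 1`, so `−p + q + r ≤ 0` with equality only at the slots).
Ledger use (RISER-LEDGER-FINDINGS.md on stmt-Ventures-19481): two foreign partners of the same
host from the same co-axial grain differ in height by a multiple of `d`, so by `ribbon_height_le`
they have EQUAL height, hence lie in same-sign lenses; the three lenses of a given sign are
disjoint pairs of in-plane slots, so `#partners ≤ ½ · #(blocked in-plane slots)` when no
out-of-plane slot is blocked — the in-plane half of the absorption inequality.
WHAT THIS IS NOT: the partner-counting itself (needs the lattice); the stub; rung F-C1 not moved.
-/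

noncomputable section

namespace Summit.Ventures.Crystal3D.Theorems

/-- **Height bound of the ribbon.**  If `(a,b,c)` has norm² `2` and inner product `≤ 1` with the
six out-of-plane slots (`|a − b| ≤ 1`, `|a − c| ≤ 1`, `|b + c| ≤ 1`), then `|−a + b + c| ≤ 2/3`. -/
theorem ribbon_height_le (a b c : ℝ) (hn : a ^ 2 + b ^ 2 + c ^ 2 = 2) (h1 : -a + b ≤ 1)
    (h2 : a - b ≤ 1) (h3 : -a + c ≤ 1) (h4 : a - c ≤ 1) (h5 : b + c ≤ 1) (h6 : -b - c ≤ 1) :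
    |-a + b + c| ≤ 2 / 3 := by
  -- `S = 2(−a+b+c) = p + q + r`, `4(p²+q²+r²) = 8 + S²`
  have key : ∀ p q r : ℝ, p ≤ 1 → -p ≤ 1 → q ≤ 1 → -q ≤ 1 → r ≤ 1 → -r ≤ 1 →
      4 * (p ^ 2 + q ^ 2 + r ^ 2) = 8 + (p + q + r) ^ 2 → p + q + r ≤ 4 / 3 := by
    intro p q r hp hp' hq hq' hr hr' hQ
    have hp2 : p ^ 2 ≤ 1 := by nlinarith [mul_nonneg (sub_nonneg.2 hp) (by linarith : (0:ℝ) ≤ 1 + p)]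
    have hq2 : q ^ 2 ≤ 1 := by nlinarith [mul_nonneg (sub_nonneg.2 hq) (by linarith : (0:ℝ) ≤ 1 + q)]
    have hr2 : r ^ 2 ≤ 1 := by nlinarith [mul_nonneg (sub_nonneg.2 hr) (by linarith : (0:ℝ) ≤ 1 + r)]
    set S := p + q + r with hS
    have hSp : S ^ 2 ≤ 4 * p ^ 2 := by nlinarith
    have hSq : S ^ 2 ≤ 4 * q ^ 2 := by nlinarith
    have hSr : S ^ 2 ≤ 4 * r ^ 2 := by nlinarith
    by_contra hgt
    push Not at hgt
    have hS0 : 0 < S := by linarith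
    -- each coordinate has `|·| ≥ S/2`; not all three can be `≥ S/2 > 0`... unless `S ≤ 0`
    have habs : ∀ t : ℝ, S ^ 2 ≤ 4 * t ^ 2 → t ≤ 1 → S / 2 ≤ t ∨ t ≤ -(S / 2) := by
      intro t ht ht1
      by_contra hc
      push Not at hc
      obtain ⟨hc1, hc2⟩ := hc
      nlinarith [mul_pos (by linarith : 0 < S / 2 - t) (by linarith : 0 < t + S / 2)]
    rcases habs p hSp hp with hp3 | hp3 <;> rcases habs q hSq hq with hq3 | hq3 <;>
      rcases habs r hSr hr with hr3 | hr3 <;> linarith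
  have hQ : 4 * ((b - a) ^ 2 + (c - a) ^ 2 + (b + c) ^ 2) = 8 + ((b - a) + (c - a) + (b + c)) ^ 2 := by
    nlinarith [hn]
  have hQ' : 4 * ((a - b) ^ 2 + (a - c) ^ 2 + (-b - c) ^ 2) =
      8 + ((a - b) + (a - c) + (-b - c)) ^ 2 := by
    nlinarith [hn]
  have up := key (b - a) (c - a) (b + c) (by linarith) (by linarith) (by linarith) (by linarith)
    (by linarith) (by linarith) hQ
  have dn := key (a - b) (a - c) (-b - c) (by linarith) (by linarith) (by linarith) (by linarith)
    (by linarith) (by linarith) hQ'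
  rw [abs_le]
  constructor <;> linarith

/-- Hexagon relations of the in-plane slots (axis `(−1,1,1)`): two distinct NON-adjacent in-plane
slots are antipodal or sum to an in-plane slot; no three in-plane slots are pairwise adjacent
(a `decide`). -/
theorem ribbon_hexagon_facts :
    (∀ u ∈ ([((1 : ℤ), (1 : ℤ), (0 : ℤ)), (-1, -1, 0), (1, 0, 1), (-1, 0, -1), (0, 1, -1), (0, -1, 1)] : List (ℤ × ℤ × ℤ)), ∀ u' ∈ ([((1 : ℤ), (1 : ℤ), (0 : ℤ)), (-1, -1, 0), (1, 0, 1), (-1, 0, -1), (0, 1, -1), (0, -1, 1)] : List (ℤ × ℤ × ℤ)),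
      u ≠ u' → u.1 * u'.1 + u.2.1 * u'.2.1 + u.2.2 * u'.2.2 ≠ 1 →
        u' = -u ∨ (u + u') ∈ ([((1 : ℤ), (1 : ℤ), (0 : ℤ)), (-1, -1, 0), (1, 0, 1), (-1, 0, -1), (0, 1, -1), (0, -1, 1)] : List (ℤ × ℤ × ℤ))) ∧
    (∀ u ∈ ([((1 : ℤ), (1 : ℤ), (0 : ℤ)), (-1, -1, 0), (1, 0, 1), (-1, 0, -1), (0, 1, -1), (0, -1, 1)] : List (ℤ × ℤ × ℤ)), ∀ u' ∈ ([((1 : ℤ), (1 : ℤ), (0 : ℤ)), (-1, -1, 0), (1, 0, 1), (-1, 0, -1), (0, 1, -1), (0, -1, 1)] : List (ℤ × ℤ × ℤ)),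
      ∀ u'' ∈ ([((1 : ℤ), (1 : ℤ), (0 : ℤ)), (-1, -1, 0), (1, 0, 1), (-1, 0, -1), (0, 1, -1), (0, -1, 1)] : List (ℤ × ℤ × ℤ)),
      u.1 * u'.1 + u.2.1 * u'.2.1 + u.2.2 * u'.2.2 = 1 →
      u.1 * u''.1 + u.2.1 * u''.2.1 + u.2.2 * u''.2.2 = 1 →
      u'.1 * u''.1 + u'.2.1 * u''.2.1 + u'.2.2 * u''.2.2 = 1 → False) := by
  refine ⟨by decide, by decide⟩

/-- **At most two in-plane slots are within overlap range, and they are adjacent.**  For `x` of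
norm² `2`: if `⟨x,u⟩ > 1` and `⟨x,u'⟩ > 1` for two distinct in-plane slots then `⟨u,u'⟩ = 1`. -/
theorem ribbon_blocked_adjacent (a b c : ℝ) (hn : a ^ 2 + b ^ 2 + c ^ 2 = 2) (u u' : ℤ × ℤ × ℤ)
    (hu : u ∈ ([((1 : ℤ), (1 : ℤ), (0 : ℤ)), (-1, -1, 0), (1, 0, 1), (-1, 0, -1), (0, 1, -1), (0, -1, 1)] : List (ℤ × ℤ × ℤ))) (hu' : u' ∈ ([((1 : ℤ), (1 : ℤ), (0 : ℤ)), (-1, -1, 0), (1, 0, 1), (-1, 0, -1), (0, 1, -1), (0, -1, 1)] : List (ℤ × ℤ × ℤ)))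
    (hne : u ≠ u') (hxu : 1 < a * (u.1 : ℝ) + b * (u.2.1 : ℝ) + c * (u.2.2 : ℝ))
    (hxu' : 1 < a * (u'.1 : ℝ) + b * (u'.2.1 : ℝ) + c * (u'.2.2 : ℝ)) :
    u.1 * u'.1 + u.2.1 * u'.2.1 + u.2.2 * u'.2.2 = 1 := by
  by_contra hdot
  -- any slot `s` has `⟨x, s⟩ ≤ 2` (Cauchy–Schwarz with both norms² `= 2`)
  have hcs : ∀ s ∈ ([((1 : ℤ), (1 : ℤ), (0 : ℤ)), (1, -1, 0), (-1, 1, 0), (-1, -1, 0), (1, 0, 1), (1, 0, -1),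
        (-1, 0, 1), (-1, 0, -1), (0, 1, 1), (0, 1, -1), (0, -1, 1), (0, -1, -1)] : List (ℤ × ℤ × ℤ)),
      a * (s.1 : ℝ) + b * (s.2.1 : ℝ) + c * (s.2.2 : ℝ) ≤ 2 := by
    intro s hs
    obtain ⟨-, hsn⟩ := cubicShell_facts s hs
    have hsr : (s.1 : ℝ) ^ 2 + (s.2.1 : ℝ) ^ 2 + (s.2.2 : ℝ) ^ 2 = 2 := by exact_mod_cast hsn
    nlinarith [sq_nonneg (a - s.1), sq_nonneg (b - s.2.1), sq_nonneg (c - s.2.2)]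
  have hUsub : ∀ s ∈ ([((1 : ℤ), (1 : ℤ), (0 : ℤ)), (-1, -1, 0), (1, 0, 1), (-1, 0, -1), (0, 1, -1), (0, -1, 1)] : List (ℤ × ℤ × ℤ)), s ∈ ([((1 : ℤ), (1 : ℤ), (0 : ℤ)), (1, -1, 0), (-1, 1, 0), (-1, -1, 0), (1, 0, 1), (1, 0, -1),
        (-1, 0, 1), (-1, 0, -1), (0, 1, 1), (0, 1, -1), (0, -1, 1), (0, -1, -1)] : List (ℤ × ℤ × ℤ)) := by
    decide
  rcases ribbon_hexagon_facts.1 u hu u' hu' hne hdot with h | h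
  · rw [h] at hxu'
    simp only [Prod.fst_neg, Prod.snd_neg, Int.cast_neg] at hxu'
    linarith
  · have h2 := hcs (u + u') (hUsub _ h)
    simp only [Prod.fst_add, Prod.snd_add, Int.cast_add] at h2
    linarith

/-- Sign of the height on the base lens (face frame): `p ≥ 1`, `q, r ≥ 0`, `q + r ≤ 1`,
`p² + q² + r² = 2` give `−p + q + r < 0` unless `(p,q,r)` is `(1,1,0)` or `(1,0,1)`. -/
theorem ribbon_sign_aux (p q r : ℝ) (hn : p ^ 2 + q ^ 2 + r ^ 2 = 2) (hp : 1 ≤ p) (hq : 0 ≤ q)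
    (hr : 0 ≤ r) (hqr : q + r ≤ 1) :
    -p + q + r < 0 ∨ (p = 1 ∧ q = 1 ∧ r = 0) ∨ (p = 1 ∧ q = 0 ∧ r = 1) := by
  by_cases hlt : -p + q + r < 0
  · exact Or.inl hlt
  · right
    push Not at hlt
    have hp1 : p = 1 := le_antisymm (by linarith) hp
    subst hp1
    rcases cubicShell_lens_ends_aux q r (by linarith) hq hr hqr with ⟨rfl, rfl⟩ | ⟨rfl, rfl⟩
    · exact Or.inl ⟨rfl, rfl, rfl⟩
    · exact Or.inr ⟨rfl, rfl, rfl⟩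

/-- **Sign rule of the ribbon.**  `x = (a,b,c)` of norm² `2`, compatible with the six out-of-plane
slots and with the four in-plane slots other than the adjacent pair `u, u'` (listed edge of the
hexagon), within overlap range of `u` and `u'`, and equal to neither: then its height `−a + b + c` and the height of the common out-of-plane neighbour
`v` of `u, u'` have OPPOSITE signs (their product is negative). -/
theorem ribbon_sign (a b c : ℝ) (hn : a ^ 2 + b ^ 2 + c ^ 2 = 2)
    (hV : ∀ v ∈ ([((1 : ℤ), (-1 : ℤ), (0 : ℤ)), (-1, 1, 0), (1, 0, -1), (-1, 0, 1), (0, 1, 1), (0, -1, -1)] : List (ℤ × ℤ × ℤ)), a * (v.1 : ℝ) + b * (v.2.1 : ℝ) + c * (v.2.2 : ℝ) ≤ 1)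
    (u u' : ℤ × ℤ × ℤ) (huu' : (u, u') ∈ ([(((1 : ℤ), (1 : ℤ), (0 : ℤ)), ((1 : ℤ), (0 : ℤ), (1 : ℤ))),
        ((1, 1, 0), (0, 1, -1)),
        ((-1, -1, 0), (-1, 0, -1)),
        ((-1, -1, 0), (0, -1, 1)),
        ((1, 0, 1), (0, -1, 1)),
        ((-1, 0, -1), (0, 1, -1))] : List ((ℤ × ℤ × ℤ) × (ℤ × ℤ × ℤ))))
    (hu : 1 < a * (u.1 : ℝ) + b * (u.2.1 : ℝ) + c * (u.2.2 : ℝ))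
    (hu' : 1 < a * (u'.1 : ℝ) + b * (u'.2.1 : ℝ) + c * (u'.2.2 : ℝ))
    (hU : ∀ s ∈ ([((1 : ℤ), (1 : ℤ), (0 : ℤ)), (-1, -1, 0), (1, 0, 1), (-1, 0, -1), (0, 1, -1), (0, -1, 1)] : List (ℤ × ℤ × ℤ)), s ≠ u → s ≠ u' →
      a * (s.1 : ℝ) + b * (s.2.1 : ℝ) + c * (s.2.2 : ℝ) ≤ 1)
    (hxu : ¬ (a = u.1 ∧ b = u.2.1 ∧ c = u.2.2)) (hxu' : ¬ (a = u'.1 ∧ b = u'.2.1 ∧ c = u'.2.2))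
    (v : ℤ × ℤ × ℤ) (hv : v ∈ ([((1 : ℤ), (-1 : ℤ), (0 : ℤ)), (-1, 1, 0), (1, 0, -1), (-1, 0, 1), (0, 1, 1), (0, -1, -1)] : List (ℤ × ℤ × ℤ)))
    (hvu : v.1 * u.1 + v.2.1 * u.2.1 + v.2.2 * u.2.2 = 1)
    (hvu' : v.1 * u'.1 + v.2.1 * u'.2.1 + v.2.2 * u'.2.2 = 1) :
    (-a + b + c) * (-(v.1 : ℝ) + v.2.1 + v.2.2) < 0 := by
  simp only [List.mem_cons, List.mem_nil_iff, or_false, Prod.mk.injEq] at huu'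
  rcases huu' with ⟨rfl, rfl⟩ | ⟨rfl, rfl⟩ | ⟨rfl, rfl⟩ | ⟨rfl, rfl⟩ | ⟨rfl, rfl⟩ | ⟨rfl, rfl⟩
  · -- edge ((1, 1, 0), (1, 0, 1)), common neighbour (0, 1, 1), frame sign 1
    simp only [List.forall_mem_cons, ne_eq, Prod.mk.injEq] at hV hU
    norm_num at hV hU hu hu'
    obtain ⟨g1, g2, g3, g4, g5, g6⟩ := hV
    obtain ⟨w1, w2, w3, w4⟩ := hU
    have hsq : (a) ^ 2 + (b) ^ 2 + (c) ^ 2 = 2 := by linear_combination hn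
    obtain ⟨hp, hq, hr⟩ := cubicShell_lens_aux (a) (b) (c) hsq (by linarith) (by linarith)
      (by linarith) (by linarith) (by linarith) (by linarith) (by linarith) (by linarith)
      (by linarith) (by linarith)
    have hqr : (b) + (c) ≤ 1 := by linarith
    have key := ribbon_sign_aux (a) (b) (c) hsq hp hq hr hqr
    rcases key with hlt | ⟨e1, e2, e3⟩ | ⟨e1, e2, e3⟩
    · simp only [List.mem_cons, List.mem_nil_iff, or_false] at hv
      rcases hv with rfl | rfl | rfl | rfl | rfl | rfl
      all_goals norm_num at hvu
      all_goals norm_num at hvu'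
      push_cast
      nlinarith [hlt]
    · exact absurd ⟨by linarith, by linarith, by linarith⟩ hxu
    · exact absurd ⟨by linarith, by linarith, by linarith⟩ hxu'
  · -- edge ((1, 1, 0), (0, 1, -1)), common neighbour (1, 0, -1), frame sign -1
    simp only [List.forall_mem_cons, ne_eq, Prod.mk.injEq] at hV hU
    norm_num at hV hU hu hu'
    obtain ⟨g1, g2, g3, g4, g5, g6⟩ := hV
    obtain ⟨w1, w2, w3, w4⟩ := hU
    have hsq : (b) ^ 2 + (a) ^ 2 + (-c) ^ 2 = 2 := by linear_combination hn
    obtain ⟨hp, hq, hr⟩ := cubicShell_lens_aux (b) (a) (-c) hsq (by linarith) (by linarith)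
      (by linarith) (by linarith) (by linarith) (by linarith) (by linarith) (by linarith)
      (by linarith) (by linarith)
    have hqr : (a) + (-c) ≤ 1 := by linarith
    have key := ribbon_sign_aux (b) (a) (-c) hsq hp hq hr hqr
    rcases key with hlt | ⟨e1, e2, e3⟩ | ⟨e1, e2, e3⟩
    · simp only [List.mem_cons, List.mem_nil_iff, or_false] at hv
      rcases hv with rfl | rfl | rfl | rfl | rfl | rfl
      all_goals norm_num at hvu
      all_goals norm_num at hvu'
      push_cast
      nlinarith [hlt]
    · exact absurd ⟨by linarith, by linarith, by linarith⟩ hxu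
    · exact absurd ⟨by linarith, by linarith, by linarith⟩ hxu'
  · -- edge ((-1, -1, 0), (-1, 0, -1)), common neighbour (0, -1, -1), frame sign -1
    simp only [List.forall_mem_cons, ne_eq, Prod.mk.injEq] at hV hU
    norm_num at hV hU hu hu'
    obtain ⟨g1, g2, g3, g4, g5, g6⟩ := hV
    obtain ⟨w1, w2, w3, w4⟩ := hU
    have hsq : (-a) ^ 2 + (-b) ^ 2 + (-c) ^ 2 = 2 := by linear_combination hn
    obtain ⟨hp, hq, hr⟩ := cubicShell_lens_aux (-a) (-b) (-c) hsq (by linarith) (by linarith)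
      (by linarith) (by linarith) (by linarith) (by linarith) (by linarith) (by linarith)
      (by linarith) (by linarith)
    have hqr : (-b) + (-c) ≤ 1 := by linarith
    have key := ribbon_sign_aux (-a) (-b) (-c) hsq hp hq hr hqr
    rcases key with hlt | ⟨e1, e2, e3⟩ | ⟨e1, e2, e3⟩
    · simp only [List.mem_cons, List.mem_nil_iff, or_false] at hv
      rcases hv with rfl | rfl | rfl | rfl | rfl | rfl
      all_goals norm_num at hvu
      all_goals norm_num at hvu'
      push_cast
      nlinarith [hlt]
    · exact absurd ⟨by linarith, by linarith, by linarith⟩ hxu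
    · exact absurd ⟨by linarith, by linarith, by linarith⟩ hxu'
  · -- edge ((-1, -1, 0), (0, -1, 1)), common neighbour (-1, 0, 1), frame sign 1
    simp only [List.forall_mem_cons, ne_eq, Prod.mk.injEq] at hV hU
    norm_num at hV hU hu hu'
    obtain ⟨g1, g2, g3, g4, g5, g6⟩ := hV
    obtain ⟨w1, w2, w3, w4⟩ := hU
    have hsq : (-b) ^ 2 + (-a) ^ 2 + (c) ^ 2 = 2 := by linear_combination hn
    obtain ⟨hp, hq, hr⟩ := cubicShell_lens_aux (-b) (-a) (c) hsq (by linarith) (by linarith)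
      (by linarith) (by linarith) (by linarith) (by linarith) (by linarith) (by linarith)
      (by linarith) (by linarith)
    have hqr : (-a) + (c) ≤ 1 := by linarith
    have key := ribbon_sign_aux (-b) (-a) (c) hsq hp hq hr hqr
    rcases key with hlt | ⟨e1, e2, e3⟩ | ⟨e1, e2, e3⟩
    · simp only [List.mem_cons, List.mem_nil_iff, or_false] at hv
      rcases hv with rfl | rfl | rfl | rfl | rfl | rfl
      all_goals norm_num at hvu
      all_goals norm_num at hvu'
      push_cast
      nlinarith [hlt]
    · exact absurd ⟨by linarith, by linarith, by linarith⟩ hxu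
    · exact absurd ⟨by linarith, by linarith, by linarith⟩ hxu'
  · -- edge ((1, 0, 1), (0, -1, 1)), common neighbour (1, -1, 0), frame sign -1
    simp only [List.forall_mem_cons, ne_eq, Prod.mk.injEq] at hV hU
    norm_num at hV hU hu hu'
    obtain ⟨g1, g2, g3, g4, g5, g6⟩ := hV
    obtain ⟨w1, w2, w3, w4⟩ := hU
    have hsq : (c) ^ 2 + (a) ^ 2 + (-b) ^ 2 = 2 := by linear_combination hn
    obtain ⟨hp, hq, hr⟩ := cubicShell_lens_aux (c) (a) (-b) hsq (by linarith) (by linarith)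
      (by linarith) (by linarith) (by linarith) (by linarith) (by linarith) (by linarith)
      (by linarith) (by linarith)
    have hqr : (a) + (-b) ≤ 1 := by linarith
    have key := ribbon_sign_aux (c) (a) (-b) hsq hp hq hr hqr
    rcases key with hlt | ⟨e1, e2, e3⟩ | ⟨e1, e2, e3⟩
    · simp only [List.mem_cons, List.mem_nil_iff, or_false] at hv
      rcases hv with rfl | rfl | rfl | rfl | rfl | rfl
      all_goals norm_num at hvu
      all_goals norm_num at hvu'
      push_cast
      nlinarith [hlt]
    · exact absurd ⟨by linarith, by linarith, by linarith⟩ hxu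
    · exact absurd ⟨by linarith, by linarith, by linarith⟩ hxu'
  · -- edge ((-1, 0, -1), (0, 1, -1)), common neighbour (-1, 1, 0), frame sign 1
    simp only [List.forall_mem_cons, ne_eq, Prod.mk.injEq] at hV hU
    norm_num at hV hU hu hu'
    obtain ⟨g1, g2, g3, g4, g5, g6⟩ := hV
    obtain ⟨w1, w2, w3, w4⟩ := hU
    have hsq : (-c) ^ 2 + (-a) ^ 2 + (b) ^ 2 = 2 := by linear_combination hn
    obtain ⟨hp, hq, hr⟩ := cubicShell_lens_aux (-c) (-a) (b) hsq (by linarith) (by linarith)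
      (by linarith) (by linarith) (by linarith) (by linarith) (by linarith) (by linarith)
      (by linarith) (by linarith)
    have hqr : (-a) + (b) ≤ 1 := by linarith
    have key := ribbon_sign_aux (-c) (-a) (b) hsq hp hq hr hqr
    rcases key with hlt | ⟨e1, e2, e3⟩ | ⟨e1, e2, e3⟩
    · simp only [List.mem_cons, List.mem_nil_iff, or_false] at hv
      rcases hv with rfl | rfl | rfl | rfl | rfl | rfl
      all_goals norm_num at hvu
      all_goals norm_num at hvu'
      push_cast
      nlinarith [hlt]
    · exact absurd ⟨by linarith, by linarith, by linarith⟩ hxu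
    · exact absurd ⟨by linarith, by linarith, by linarith⟩ hxu'

end Summit.Ventures.Crystal3D.Theorems

end
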